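import Mathlib
import HarnessLib
import Summits.Ventures.LatticeQCDFlow.Exactness.FrozenExteriorPenalty

/-!
# The frozen-exterior Kish-ESS ceiling of a restricted-kernel switching protocol

HONEST FRAMING: exact (Metropolis-corrected) sampling algorithms for lattice gauge theory;
figures of merit are autocorrelation/cost numbers at stated couplings and volumes; no
continuum-physics claim.

Venture `LatticeQCDFlow` (cell pub-lqcd), topic `Exactness`; FANOUT row 8 (`s0-cpn-nemc`, GEN-7),
landing the flow seat's offered sketch `HOME/canary-flow/ballq/lean/EssCeiling.lean` (gen-12, R6 of
`BALL-FLOOR-flow.md`; lemmas `condMean_sq_le`, `ess_path_le_ess_condMean`) in the vocabulary of row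
13's `Exactness/FrozenExteriorPenalty.lean` — the FIRST-MOMENT half (the quenched penalty
`Q = Σ_y p_y ΔF(y) − annealedDeltaF ≥ 0` bounds the dissipation `⟨W⟩ − ΔF` of every frozen-exterior
protocol from below).  This file is the SECOND-MOMENT half; `Exactness/FrozenExteriorMarginals.lean`
identifies ceiling and penalty with divergences of the exterior marginals.  NEW WORK of the cell
(elementary finite sums: the law of total variance and Jensen for squares), not a published result;
nothing is cited as a fact.  Companion: `Exactness/SampleESS.lean` (the sample Kish statistic).

## Setting (as in `FrozenExteriorPenalty.lean`)

A finite exterior alphabet `Y` with prior weights `p`; for every frozen exterior `y` a finite path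
space `Ω` with path probabilities `q y ω` (each row a probability vector) and importance weights
`w y ω` — for a switching protocol `w = e^{−W}`, `W` the work.  The exterior is NOT updated during the
evolution (`latflow.snf` lever `protocol.sweep_region = defect-ball`), so the law of the pair
(exterior, path) is the mixture `p_y · q_{y,ω}`.

## Content

* `wmean_sq_dev_eq`, `sq_wmean_le_wmean_sq`, `sq_wmean_eq_wmean_sq_iff` — one-level weighted
  variance identity `Σ p (a − μ)² = Σ p a² − μ²`, Jensen for squares, and its equality case;
* `frozen_total_variance` — law of total variance for the mixture,
  `Σ_y p_y Σ_ω q (w − m_y)² = E[w²] − Σ_y p_y m_y²` with `m_y = pathCondMean q w y = E[w | y]`; hence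
  `pathCondMean_sq_le` (`Σ_y p_y m_y² ≤ E[w²]`, the flow seat's `condMean_sq_le`) with equality case
  `pathCondMean_sq_eq_iff` (iff `w` is constant on every exterior's path support: zero conditional
  variance, i.e. deterministic work given the exterior);
* **`mixtureKish_le_condMeanKish`** — DATA PROCESSING FOR THE KISH FRACTION: the population Kish
  effective-sample-size fraction `(E w)²/E[w²]` of the path weights is at most the Kish fraction of
  the conditional means (the flow seat's `ess_path_le_ess_condMean`, here without positivity side
  conditions); NOTHING about the number of protocol steps or the kernel inside the ball enters;
* under PER-EXTERIOR JARZYNSKI `Σ_ω q_{y,ω} e^{−W_{y,ω}} = e^{−ΔF(y)}` (which masked / frozen-block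
  kernels deliver, `LocalUpdates.lean`, and which keeps the mixture exact for the ANNEALED `ΔF`,
  `mixture_jarzynski`) the conditional mean is `e^{−ΔF(y)}`, so
  **`mixtureKish_le_ceiling_of_jarzynski`**: Kish-ESS ≤ `frozenExteriorEssCeiling p ΔF :=
  (Σ_y p_y e^{−ΔF(y)})² / Σ_y p_y e^{−2ΔF(y)}` for EVERY `n_step` and every exterior-freezing interior
  kernel (heat bath, over-relaxation, trained ball-restricted layers alike); the mixture's Kish
  fraction itself is `e^{−2·annealedDeltaF}/E[e^{−2W}]` (`mixtureKish_eq_of_jarzynski`, the population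
  form of the engine's `ÊSS`);
* `0 <` ceiling `≤ 1` and **`frozenExteriorEssCeiling_eq_one_iff`**: ceiling `= 1` iff `ΔF` is constant
  on the support of `p` iff the first-moment penalty vanishes
  (`frozenExteriorEssCeiling_eq_one_iff_penalty_eq_zero`);
* **`mixtureKish_eq_ceiling_iff_of_jarzynski`** — the ceiling is ATTAINED iff the work is
  deterministic given the exterior (`W_{y,ω} = ΔF(y)` on the support: a dissipation-free interior),
  the case the quasi-static limit approaches; otherwise the Kish fraction is strictly below it.

Reading (flow seat BALL-FLOOR-flow.md §1–§2 and row 13's eqscan evidence; theirs, quoted): floor `Q`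
and this ceiling are properties of the OUTERMOST region ever swept; `n_step`, `n_relax`, better or
learned interior kernels and finer booking never touch them.
-/

namespace Summit.Ventures.LatticeQCDFlow.Exactness

open Finset Real

section WeightedSquares

variable {Y : Type*} [Fintype Y]

/-- One-level weighted variance identity: for weights summing to one,
`Σ_y p_y (a_y − μ)² = Σ_y p_y a_y² − μ²` with `μ = Σ_y p_y a_y`. -/
theorem wmean_sq_dev_eq (p a : Y → ℝ) (hsum : ∑ y, p y = 1) :
    ∑ y, p y * (a y - ∑ y', p y' * a y') ^ 2
      = ∑ y, p y * a y ^ 2 - (∑ y, p y * a y) ^ 2 := by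
  set μ := ∑ y', p y' * a y' with hμ
  have h : ∀ y, p y * (a y - μ) ^ 2 = p y * a y ^ 2 - 2 * μ * (p y * a y) + μ ^ 2 * p y := by
    intro y; ring
  simp only [h, Finset.sum_add_distrib, Finset.sum_sub_distrib, ← Finset.mul_sum, hsum, ← hμ]
  ring

/-- Jensen for squares with probability weights: `(Σ p a)² ≤ Σ p a²`. -/
theorem sq_wmean_le_wmean_sq (p a : Y → ℝ) (hp : ∀ y, 0 ≤ p y) (hsum : ∑ y, p y = 1) :
    (∑ y, p y * a y) ^ 2 ≤ ∑ y, p y * a y ^ 2 := by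
  have h := wmean_sq_dev_eq p a hsum
  have hnn : 0 ≤ ∑ y, p y * (a y - ∑ y', p y' * a y') ^ 2 :=
    Finset.sum_nonneg fun y _ => mul_nonneg (hp y) (sq_nonneg _)
  linarith

/-- Equality case of Jensen for squares: `(Σ p a)² = Σ p a²` iff `a` is constant (equal to its
mean) on the support of `p`. -/
theorem sq_wmean_eq_wmean_sq_iff (p a : Y → ℝ) (hp : ∀ y, 0 ≤ p y) (hsum : ∑ y, p y = 1) :
    (∑ y, p y * a y) ^ 2 = ∑ y, p y * a y ^ 2 ↔
      ∀ y, p y ≠ 0 → a y = ∑ y', p y' * a y' := by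
  have h := wmean_sq_dev_eq p a hsum
  have hterm : ∀ y, 0 ≤ p y * (a y - ∑ y', p y' * a y') ^ 2 :=
    fun y => mul_nonneg (hp y) (sq_nonneg _)
  constructor
  · intro heq y hpy
    have h0 : ∑ y, p y * (a y - ∑ y', p y' * a y') ^ 2 = 0 := by rw [h]; linarith
    have hy := (Finset.sum_eq_zero_iff_of_nonneg fun y _ => hterm y).mp h0 y (Finset.mem_univ y)
    rcases mul_eq_zero.mp hy with h1 | h1
    · exact absurd h1 hpy
    · have := (pow_eq_zero_iff two_ne_zero).mp h1
      linarith
  · intro hc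
    have h0 : ∑ y, p y * (a y - ∑ y', p y' * a y') ^ 2 = 0 := by
      refine Finset.sum_eq_zero fun y _ => ?_
      by_cases hpy : p y = 0
      · rw [hpy, zero_mul]
      · rw [hc y hpy, sub_self]; ring
    rw [h] at h0
    linarith

end WeightedSquares

section FrozenExteriorESS

variable {Y : Type*} [Fintype Y] {Ω : Type*} [Fintype Ω]

/-! ## Conditional means and the law of total variance for the mixture of frozen exteriors -/

/-- The conditional mean `E[w | y] = Σ_ω q_{y,ω} w_{y,ω}` of the path weight given the frozen
exterior `y`. -/
def pathCondMean (q w : Y → Ω → ℝ) (y : Y) : ℝ := ∑ ω, q y ω * w y ω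

/-- LAW OF TOTAL VARIANCE (within part) for the mixture `p_y q_{y,ω}`: the `p`-average of the
conditional variances equals `E[w²] − Σ_y p_y m_y²`, `m_y = E[w | y]`. -/
theorem frozen_total_variance (p : Y → ℝ) (q w : Y → Ω → ℝ) (hqs : ∀ y, ∑ ω, q y ω = 1) :
    ∑ y, p y * ∑ ω, q y ω * (w y ω - pathCondMean q w y) ^ 2
      = ∑ y, p y * ∑ ω, q y ω * w y ω ^ 2 - ∑ y, p y * pathCondMean q w y ^ 2 := by
  rw [← Finset.sum_sub_distrib]
  refine Finset.sum_congr rfl fun y _ => ?_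
  have h := wmean_sq_dev_eq (q y) (w y) (hqs y)
  simp only [pathCondMean]
  rw [h]
  ring

/-- SECOND MOMENTS DOMINATE SQUARED CONDITIONAL MEANS (the flow seat's `condMean_sq_le`):
`Σ_y p_y (E[w | y])² ≤ E[w²]` for `p ≥ 0` and probability rows `q_y`. -/
theorem pathCondMean_sq_le {p : Y → ℝ} {q w : Y → Ω → ℝ} (hp : ∀ y, 0 ≤ p y)
    (hq : ∀ y ω, 0 ≤ q y ω) (hqs : ∀ y, ∑ ω, q y ω = 1) :
    ∑ y, p y * pathCondMean q w y ^ 2 ≤ ∑ y, p y * ∑ ω, q y ω * w y ω ^ 2 := by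
  have h := frozen_total_variance p q w hqs
  have hnn : 0 ≤ ∑ y, p y * ∑ ω, q y ω * (w y ω - pathCondMean q w y) ^ 2 :=
    Finset.sum_nonneg fun y _ => mul_nonneg (hp y)
      (Finset.sum_nonneg fun ω _ => mul_nonneg (hq y ω) (sq_nonneg _))
  linarith

/-- Equality case: `Σ_y p_y (E[w | y])² = E[w²]` iff on every exterior of positive weight the path
weight is constant (equal to its conditional mean) on the support of `q_y` — zero conditional
variance, i.e. deterministic work given the exterior. -/
theorem pathCondMean_sq_eq_iff {p : Y → ℝ} {q w : Y → Ω → ℝ} (hp : ∀ y, 0 ≤ p y)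
    (hq : ∀ y ω, 0 ≤ q y ω) (hqs : ∀ y, ∑ ω, q y ω = 1) :
    ∑ y, p y * pathCondMean q w y ^ 2 = ∑ y, p y * ∑ ω, q y ω * w y ω ^ 2 ↔
      ∀ y ω, p y ≠ 0 → q y ω ≠ 0 → w y ω = pathCondMean q w y := by
  have h := frozen_total_variance p q w hqs
  have hin : ∀ y, 0 ≤ ∑ ω, q y ω * (w y ω - pathCondMean q w y) ^ 2 :=
    fun y => Finset.sum_nonneg fun ω _ => mul_nonneg (hq y ω) (sq_nonneg _)
  have hterm : ∀ y, 0 ≤ p y * ∑ ω, q y ω * (w y ω - pathCondMean q w y) ^ 2 :=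
    fun y => mul_nonneg (hp y) (hin y)
  constructor
  · intro heq y ω hpy hqy
    have h0 : ∑ y, p y * ∑ ω, q y ω * (w y ω - pathCondMean q w y) ^ 2 = 0 := by
      rw [h]; linarith
    have hy := (Finset.sum_eq_zero_iff_of_nonneg fun y _ => hterm y).mp h0 y (Finset.mem_univ y)
    rcases mul_eq_zero.mp hy with h1 | h1
    · exact absurd h1 hpy
    · have hω := (Finset.sum_eq_zero_iff_of_nonneg fun ω _ =>
        mul_nonneg (hq y ω) (sq_nonneg _)).mp h1 ω (Finset.mem_univ ω)
      rcases mul_eq_zero.mp hω with h2 | h2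
      · exact absurd h2 hqy
      · have := (pow_eq_zero_iff two_ne_zero).mp h2
        linarith
  · intro hc
    have h0 : ∑ y, p y * ∑ ω, q y ω * (w y ω - pathCondMean q w y) ^ 2 = 0 := by
      refine Finset.sum_eq_zero fun y _ => ?_
      by_cases hpy : p y = 0
      · rw [hpy, zero_mul]
      · have : ∑ ω, q y ω * (w y ω - pathCondMean q w y) ^ 2 = 0 := by
          refine Finset.sum_eq_zero fun ω _ => ?_
          by_cases hqy : q y ω = 0
          · rw [hqy, zero_mul]
          · rw [hc y ω hpy hqy, sub_self]; ring
        rw [this, mul_zero]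
    rw [h] at h0
    linarith

/-! ## Kish fractions: data processing -/

/-- The population Kish effective-sample-size fraction `(E w)² / E[w²]` of the path weights under
the mixture law `p_y q_{y,ω}` (`E w = Σ_y p_y E[w | y]`). -/
noncomputable def mixtureKish (p : Y → ℝ) (q w : Y → Ω → ℝ) : ℝ :=
  (∑ y, p y * pathCondMean q w y) ^ 2 / ∑ y, p y * ∑ ω, q y ω * w y ω ^ 2

/-- The Kish fraction `(Σ_y p_y m_y)² / Σ_y p_y m_y²` of the conditional means `m_y = E[w | y]` — a
function of the exterior marginals only. -/
noncomputable def condMeanKish (p : Y → ℝ) (q w : Y → Ω → ℝ) : ℝ :=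
  (∑ y, p y * pathCondMean q w y) ^ 2 / ∑ y, p y * pathCondMean q w y ^ 2

/-- **DATA PROCESSING FOR THE KISH FRACTION** (the flow seat's `ess_path_le_ess_condMean`, without
positivity side conditions): the Kish fraction of the path weights is at most the Kish fraction of
their conditional means given the frozen exterior.  Nothing about the number of protocol steps or the
kernel inside the ball enters. -/
theorem mixtureKish_le_condMeanKish {p : Y → ℝ} {q w : Y → Ω → ℝ} (hp : ∀ y, 0 ≤ p y)
    (hq : ∀ y ω, 0 ≤ q y ω) (hqs : ∀ y, ∑ ω, q y ω = 1) :
    mixtureKish p q w ≤ condMeanKish p q w := by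
  unfold mixtureKish condMeanKish
  have hnn : 0 ≤ ∑ y, p y * pathCondMean q w y ^ 2 :=
    Finset.sum_nonneg fun y _ => mul_nonneg (hp y) (sq_nonneg _)
  by_cases hpos : 0 < ∑ y, p y * pathCondMean q w y ^ 2
  · exact div_le_div_of_nonneg_left (sq_nonneg _) hpos (pathCondMean_sq_le hp hq hqs)
  · have h0 : ∑ y, p y * pathCondMean q w y ^ 2 = 0 := le_antisymm (not_lt.mp hpos) hnn
    have hnum : ∑ y, p y * pathCondMean q w y = 0 := by
      refine Finset.sum_eq_zero fun y _ => ?_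
      have hy := (Finset.sum_eq_zero_iff_of_nonneg fun y _ =>
        mul_nonneg (hp y) (sq_nonneg (pathCondMean q w y))).mp h0 y (Finset.mem_univ y)
      rcases mul_eq_zero.mp hy with h1 | h1
      · rw [h1, zero_mul]
      · rw [(pow_eq_zero_iff two_ne_zero).mp h1, mul_zero]
    rw [hnum, h0]
    simp

/-! ## Per-exterior Jarzynski: the ceiling -/

/-- The FROZEN-EXTERIOR KISH-ESS CEILING `(Σ_y p_y e^{−ΔF(y)})² / Σ_y p_y e^{−2ΔF(y)}`: the Kish
fraction of the conditional means `e^{−ΔF(y)}`, a function of the prior exterior weights `p` and the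
conditional free-energy differences `ΔF` only. -/
noncomputable def frozenExteriorEssCeiling (p dF : Y → ℝ) : ℝ :=
  (∑ y, p y * Real.exp (-dF y)) ^ 2 / ∑ y, p y * Real.exp (-dF y) ^ 2

omit [Fintype Y] in
/-- Under per-exterior Jarzynski the conditional mean of `e^{−W}` given `y` is `e^{−ΔF(y)}`. -/
theorem pathCondMean_expNegWork {q W : Y → Ω → ℝ} {dF : Y → ℝ}
    (hJ : ∀ y, ∑ ω, q y ω * Real.exp (-W y ω) = Real.exp (-dF y)) (y : Y) :
    pathCondMean q (fun y ω => Real.exp (-W y ω)) y = Real.exp (-dF y) := hJ y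

/-- Under per-exterior Jarzynski the Kish fraction of the conditional means is the ceiling. -/
theorem condMeanKish_eq_ceiling {p : Y → ℝ} {q W : Y → Ω → ℝ} {dF : Y → ℝ}
    (hJ : ∀ y, ∑ ω, q y ω * Real.exp (-W y ω) = Real.exp (-dF y)) :
    condMeanKish p q (fun y ω => Real.exp (-W y ω)) = frozenExteriorEssCeiling p dF := by
  unfold condMeanKish frozenExteriorEssCeiling
  simp only [pathCondMean_expNegWork hJ]

/-- Under per-exterior Jarzynski the numerator of the path Kish fraction is `e^{−2·annealedDeltaF}`
(`FrozenExteriorPenalty.mixture_jarzynski`): the mixture Kish fraction is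
`e^{−2·annealedDeltaF} / E[e^{−2W}]`, the population form of the engine's `ÊSS = (Σ e^{−W})²/(N Σ e^{−2W})`. -/
theorem mixtureKish_eq_of_jarzynski {p : Y → ℝ} {q W : Y → Ω → ℝ} {dF : Y → ℝ}
    (hp : ∀ y, 0 ≤ p y) (hsum : ∑ y, p y = 1)
    (hJ : ∀ y, ∑ ω, q y ω * Real.exp (-W y ω) = Real.exp (-dF y)) :
    mixtureKish p q (fun y ω => Real.exp (-W y ω))
      = Real.exp (-2 * annealedDeltaF p dF) / ∑ y, p y * ∑ ω, q y ω * Real.exp (-2 * W y ω) := by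
  unfold mixtureKish
  have hnum : ∑ y, p y * pathCondMean q (fun y ω => Real.exp (-W y ω)) y
      = Real.exp (-annealedDeltaF p dF) := by
    simp only [pathCondMean]
    exact mixture_jarzynski hp hsum hJ
  rw [hnum, ← Real.exp_nat_mul]
  congr 1
  · norm_num
  · refine Finset.sum_congr rfl fun y _ => ?_
    congr 1
    refine Finset.sum_congr rfl fun ω _ => ?_
    rw [← Real.exp_nat_mul]
    norm_num

/-- **THE KISH-ESS CEILING OF A FROZEN-EXTERIOR PROTOCOL.**  If every exterior `y` obeys Jarzynski on
its path space, then — for EVERY number of steps and every exterior-freezing interior kernel — the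
Kish fraction of the path weights `e^{−W}` is at most `frozenExteriorEssCeiling p ΔF`. -/
theorem mixtureKish_le_ceiling_of_jarzynski {p : Y → ℝ} {q W : Y → Ω → ℝ} {dF : Y → ℝ}
    (hp : ∀ y, 0 ≤ p y) (hq : ∀ y ω, 0 ≤ q y ω) (hqs : ∀ y, ∑ ω, q y ω = 1)
    (hJ : ∀ y, ∑ ω, q y ω * Real.exp (-W y ω) = Real.exp (-dF y)) :
    mixtureKish p q (fun y ω => Real.exp (-W y ω)) ≤ frozenExteriorEssCeiling p dF := by
  rw [← condMeanKish_eq_ceiling hJ]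
  exact mixtureKish_le_condMeanKish hp hq hqs

/-! ## Properties of the ceiling -/

/-- The ceiling's denominator `Σ_y p_y e^{−2ΔF(y)}` is positive for probability weights. -/
theorem ceilingDen_pos {p dF : Y → ℝ} (hp : ∀ y, 0 ≤ p y) (hsum : ∑ y, p y = 1) :
    0 < ∑ y, p y * Real.exp (-dF y) ^ 2 :=
  lt_of_lt_of_le (pow_pos (mixtureSum_pos (dF := dF) hp hsum) 2)
    (sq_wmean_le_wmean_sq p (fun y => Real.exp (-dF y)) hp hsum)

/-- The ceiling is positive. -/
theorem frozenExteriorEssCeiling_pos {p dF : Y → ℝ} (hp : ∀ y, 0 ≤ p y) (hsum : ∑ y, p y = 1) :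
    0 < frozenExteriorEssCeiling p dF :=
  div_pos (pow_pos (mixtureSum_pos (dF := dF) hp hsum) 2) (ceilingDen_pos hp hsum)

/-- The ceiling is at most one (Jensen for squares). -/
theorem frozenExteriorEssCeiling_le_one {p dF : Y → ℝ} (hp : ∀ y, 0 ≤ p y)
    (hsum : ∑ y, p y = 1) : frozenExteriorEssCeiling p dF ≤ 1 :=
  (div_le_one (ceilingDen_pos hp hsum)).mpr
    (sq_wmean_le_wmean_sq p (fun y => Real.exp (-dF y)) hp hsum)

/-- **EQUALITY CASE.**  The ceiling equals one iff `ΔF` is constant on the support of `p` — the same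
condition under which the first-moment penalty vanishes
(`FrozenExteriorPenalty.frozenExteriorPenalty_eq_zero_iff`). -/
theorem frozenExteriorEssCeiling_eq_one_iff {p dF : Y → ℝ} (hp : ∀ y, 0 ≤ p y)
    (hsum : ∑ y, p y = 1) :
    frozenExteriorEssCeiling p dF = 1 ↔
      ∀ ⦃y⦄, p y ≠ 0 → ∀ ⦃y'⦄, p y' ≠ 0 → dF y = dF y' := by
  unfold frozenExteriorEssCeiling
  rw [div_eq_one_iff_eq (ceilingDen_pos hp hsum).ne',
    sq_wmean_eq_wmean_sq_iff p (fun y => Real.exp (-dF y)) hp hsum]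
  constructor
  · intro h y hy y' hy'
    have h1 := h y hy
    have h2 := h y' hy'
    have : Real.exp (-dF y) = Real.exp (-dF y') := by rw [h1, h2]
    have := Real.exp_injective this
    linarith
  · intro h y hy
    symm
    calc ∑ y', p y' * Real.exp (-dF y') = ∑ y', p y' * Real.exp (-dF y) := by
          refine Finset.sum_congr rfl fun y' _ => ?_
          by_cases hy' : p y' = 0
          · rw [hy', zero_mul, zero_mul]
          · rw [h hy' hy]
      _ = Real.exp (-dF y) := by rw [← Finset.sum_mul, hsum, one_mul]

/-- The ceiling equals one iff the first-moment penalty vanishes. -/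
theorem frozenExteriorEssCeiling_eq_one_iff_penalty_eq_zero {p dF : Y → ℝ} (hp : ∀ y, 0 ≤ p y)
    (hsum : ∑ y, p y = 1) :
    frozenExteriorEssCeiling p dF = 1 ↔ frozenExteriorPenalty p dF = 0 := by
  rw [frozenExteriorEssCeiling_eq_one_iff hp hsum, frozenExteriorPenalty_eq_zero_iff hp hsum]

/-- **WHEN IS THE CEILING ATTAINED?**  Under per-exterior Jarzynski (probability weights `p`), the
path Kish fraction EQUALS the ceiling iff on every exterior of positive weight the work is
deterministic on the path support, `W_{y,ω} = ΔF(y)` — a dissipation-free interior protocol given the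
frozen exterior (the quasi-static limit the engine's `n_step → ∞` scans approach); short of that the
Kish fraction is STRICTLY below the ceiling. -/
theorem mixtureKish_eq_ceiling_iff_of_jarzynski {p : Y → ℝ} {q W : Y → Ω → ℝ} {dF : Y → ℝ}
    (hp : ∀ y, 0 ≤ p y) (hsum : ∑ y, p y = 1) (hq : ∀ y ω, 0 ≤ q y ω)
    (hqs : ∀ y, ∑ ω, q y ω = 1)
    (hJ : ∀ y, ∑ ω, q y ω * Real.exp (-W y ω) = Real.exp (-dF y)) :
    mixtureKish p q (fun y ω => Real.exp (-W y ω)) = frozenExteriorEssCeiling p dF ↔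
      ∀ y ω, p y ≠ 0 → q y ω ≠ 0 → W y ω = dF y := by
  rw [← condMeanKish_eq_ceiling hJ]
  unfold mixtureKish condMeanKish
  have hnum : ∑ y, p y * pathCondMean q (fun y ω => Real.exp (-W y ω)) y
      = Real.exp (-annealedDeltaF p dF) := by
    simp only [pathCondMean]
    exact mixture_jarzynski hp hsum hJ
  have hnum_pos : 0 < (∑ y, p y * pathCondMean q (fun y ω => Real.exp (-W y ω)) y) ^ 2 := by
    rw [hnum]; exact pow_pos (Real.exp_pos _) 2
  have hB : 0 < ∑ y, p y * pathCondMean q (fun y ω => Real.exp (-W y ω)) y ^ 2 := by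
    simp only [pathCondMean_expNegWork hJ]
    exact ceilingDen_pos hp hsum
  have hA : 0 < ∑ y, p y * ∑ ω, q y ω * Real.exp (-W y ω) ^ 2 :=
    lt_of_lt_of_le hB (pathCondMean_sq_le hp hq hqs)
  rw [div_eq_div_iff hA.ne' hB.ne', mul_right_inj' hnum_pos.ne',
    pathCondMean_sq_eq_iff (w := fun y ω => Real.exp (-W y ω)) hp hq hqs]
  simp only [pathCondMean_expNegWork hJ]
  constructor
  · intro h y ω hpy hqy
    have := Real.exp_injective (h y ω hpy hqy)
    linarith
  · intro h y ω hpy hqy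
    rw [h y ω hpy hqy]

end FrozenExteriorESS

end Summit.Ventures.LatticeQCDFlow.Exactness
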